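import Summits.HubbardSuperconductivity.HubbardSuperconductivity.Theorems.AnisotropyChordTransferFibre3RowDBTerm

/-!
# Route `AnisotropyChord` / H0 rotor rung, row D (KT-2a) Stage-1 evaluator: the `D`-boundary closed half ASSEMBLED — `bTermE`

Layer F2b (assembly) of the row-D program (p1 g30), continuation of `…RowDBTerm`: the nine-term combination of g29's `bLinesG` with
`Z2 = closed2U`, mirrored as an `RExpr` pair.  Lines ★ `lineCE/lineCE'/lineCE''` (the `C0` parts: four `e ∈ E4`, (plain, gradient) pairs
`zPG`) and ★ `lineME` (the spectator parts: `e = ±x̂`, prefactor `e^{iθeₓ} − 1 = sph(−eₓ)`, (shift, plain)/(plain, shift) pairs `zSP/zPS`),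
with `V·peval = ` the corresponding `let` of `bLinesG` (★ `lineCE_eval`, …, ★ `lineME_eval`); ★ `bLinesE k3 k1 k2 k₂ k₃` with
★ `bLinesE_eval : V·peval(bLinesE) = bClosedU(k̄₂,k̄₃)` under the decidable ★ `bOk k₂ k₃` (every momentum a grid point with `|q·e| ≤ 3`), and
★ `bTermE := (1/4π²)·bLinesE`, ★ `bTermE_eval : V²·t·peval(bTermE) = bClosedU(k̄₂,k̄₃)` (`Vt = 4π²`).
Prover seat `hubbard-h0-rotor-p1` g30 (route lead); helper for piece A = stmt-HubbardSuperconductivity-23918 of rung 19089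
(`--supports`, helper class).  Nothing here proves superconductivity in the Hubbard model; lemmas for ONE row of ONE conditional reduction;
the rotor TARGET as originally worded stays FALSE (g15 verdict).  Tree imports only; no sorry.
-/

set_option linter.dupNamespace false
set_option autoImplicit false

open Literature.Analysis.ValidatedNumerics

namespace Summit.HubbardSuperconductivity.HubbardSuperconductivity.Theorems.AnisotropyChord.Transfer.Fibre3

namespace RowD

open RowC L2.N1

variable (L : ℕ) [NeZero L]

/-! ## The boundary lines as a pair -/

/-- the integer `±x̂`. -/
def E2 : List (ℤ × ℤ) := [(1, 0), (-1, 0)]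

/-- line of type `C` with the two pair transforms (plain `x`, grad `y`) and (plain `y`, grad `x`), point value `p`. -/
def lineCE (p : RExpr) (x y : Bool) (q : ℤ × ℤ) : RExpr × RExpr :=
  pscale (cst (1 / 2)) (psum (E4.map fun e => padd (pscale p (zPG x y q e)) (pscale p (zPG y x q e))))

/-- line of type `C′` (mirrored second transform, lines `B`): `p·(Z(x plain, y grad e) + Z(y plain (−e), x grad (−e)))`. -/
def lineCE' (p : RExpr) (x y : Bool) (q : ℤ × ℤ) : RExpr × RExpr :=
  pscale (cst (1 / 2)) (psum (E4.map fun e => pscale p (padd (zPG x y q e) (zPG y x q (-e)))))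

/-- line of type `C″` (line `D`): `p·(Z(y plain (−e), x grad (−e)) + Z(x plain e, y grad e))`. -/
def lineCE'' (p : RExpr) (x y : Bool) (q : ℤ × ℤ) : RExpr × RExpr :=
  pscale (cst (1 / 2)) (psum (E4.map fun e => pscale p (padd (zPG y x q (-e)) (zPG x y q e))))

/-- line of type `M`: `−½ Σ_{e=±x̂} (e^{iθeₓ} − 1)·[p·Z(x shift σe, y plain) + p·Z(x plain, y shift σe)]`, `σ ∈ {+,−}`. -/
def lineME (p : RExpr) (x y : Bool) (σ : Bool) (q : ℤ × ℤ) : RExpr × RExpr :=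
  pscale (cst (-1 / 2)) (psum (E2.map fun e =>
    ofS (pmulS (padd (pscale p (zSP x y q (if σ then -e else e))) (pscale p (zPS x y q (if σ then -e else e))))
      (sph (-(qdot exI e))))))

/-- ★ `bClosedU/V` as a pair: the nine-term combination of `bLinesG`. -/
def bLinesE (k3 k1 k2 : Bool) (k₂ k₃ : ℤ × ℤ) : RExpr × RExpr :=
  padd (padd
    (padd (padd (pscale (cst 2) (lineCE (pvE k1) k3 k2 k₃)) (lineCE (pvE k1) k3 k2 (k₃ - exI))) (lineME (pvE k1) k2 k3 false k₃))
    (padd (padd (pscale (cst 2) (lineCE' (pvE k2) k3 k1 k₂)) (lineCE' (pvE k2) k3 k1 (k₂ - exI))) (lineME (pvE k2) k1 k3 false k₂)))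
    (padd (padd (lineCE'' (pvE k3) k1 k2 (k₂ + k₃)) (pscale (cst 2) (lineCE'' (pvE k3) k1 k2 (k₂ + k₃ - exI))))
      (lineME (pvE k3) k1 k2 true (k₂ + k₃ - exI)))

/-- ★ `bClosedU/(V²t)` as a pair (`1/(Vt) = 1/(4π²)`). -/
def bTermE (k3 k1 k2 : Bool) (k₂ k₃ : ℤ × ℤ) : RExpr × RExpr :=
  pscale (.inv (.mul (cst 4) vPi2)) (bLinesE k3 k1 k2 k₂ k₃)

/-- admissibility of one momentum: grid point (or `0`) with all `|q·e| ≤ 3`. -/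
def okB (q : ℤ × ℤ) : Bool := okPt q && okMul q

/-- ★ the decidable side condition of `bLinesE_eval`. -/
def bOk (k₂ k₃ : ℤ × ℤ) : Bool :=
  okB k₃ && okB (k₃ - exI) && okB k₂ && okB (k₂ - exI) && okB (k₂ + k₃) && okB (k₂ + k₃ - exI)

section assembly
variable (Δ lam2 : ℝ) (f : Tor L → ℝ)

omit [NeZero L] in
/-- reading `okB`. -/
theorem okB_imp {q : ℤ × ℤ} (h : okB q = true) : (q = (0, 0) ∨ q ∈ gridPts 3) ∧ ∀ e ∈ E4, (qdot q e).natAbs ≤ 3 := by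
  simp only [okB, Bool.and_eq_true, okPt_iff] at h
  exact ⟨h.1, okMul_imp h.2⟩

omit [NeZero L] in
/-- `|q·(−e)| = |q·e|`. -/
theorem natAbs_qdot_neg (q e : ℤ × ℤ) : (qdot q (-e)).natAbs = (qdot q e).natAbs := by
  unfold qdot; simp only [Prod.fst_neg, Prod.snd_neg]; rw [← Int.natAbs_neg]; ring_nf

/-- ★ line `C`: `V·peval(lineCE p x y q) = ½ Σ_{e∈nn} [p Z(ψ_x plain e, ψ_y grad e)(q̄) + p Z(ψ_y plain e, ψ_x grad e)(q̄)]` (closed parts). -/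
theorem lineCE_eval (hL : 5 ≤ L) (hΔ0 : 0 ≤ Δ) (hΔ1 : Δ < 1) (hf : IsGroundTwoMagnon L Δ lam2 f) (hlam : 0 < lam2)
    (kp : Bool) (x y : Bool) {q : ℤ × ℤ} (hq : okB q = true) :
    (L : ℂ) ^ 2 * peval (2 * Real.pi / L) (xTrueD L Δ lam2 f) (lineCE (pvE kp) x y q)
      = (1 / 2) * ((nnList L).map (fun e =>
          ((pvR L Δ lam2 f kp : ℝ) : ℂ) * closed2U L lam2 (psiU L Δ lam2 f x 1 0 e) (psiU L Δ lam2 f y 1 (-1) e) (B1.toTor L q)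
          + ((pvR L Δ lam2 f kp : ℝ) : ℂ) * closed2U L lam2 (psiU L Δ lam2 f y 1 0 e) (psiU L Δ lam2 f x 1 (-1) e) (B1.toTor L q))).sum := by
  obtain ⟨hq0, hm⟩ := okB_imp hq
  have hp := eval_pvE L Δ lam2 f kp
  have T : ∀ e ∈ E4, (L : ℂ) ^ 2 * peval (2 * Real.pi / L) (xTrueD L Δ lam2 f) (padd (pscale (pvE kp) (zPG x y q e)) (pscale (pvE kp) (zPG y x q e)))
      = ((pvR L Δ lam2 f kp : ℝ) : ℂ) * closed2U L lam2 (psiU L Δ lam2 f x 1 0 (B1.toTor L e)) (psiU L Δ lam2 f y 1 (-1) (B1.toTor L e)) (B1.toTor L q)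
        + ((pvR L Δ lam2 f kp : ℝ) : ℂ) * closed2U L lam2 (psiU L Δ lam2 f y 1 0 (B1.toTor L e)) (psiU L Δ lam2 f x 1 (-1) (B1.toTor L e)) (B1.toTor L q) := by
    intro e he
    have A := zPG_eval L Δ lam2 f hL hΔ0 hΔ1 hf hlam x y (B1.toTor L e) hq0 e (hm e he)
    have B := zPG_eval L Δ lam2 f hL hΔ0 hΔ1 hf hlam y x (B1.toTor L e) hq0 e (hm e he)
    rw [peval_padd, peval_pscale, peval_pscale, hp, mul_add, ← A, ← B]; ring
  have e1 := T (1, 0) (by decide); have e2 := T (-1, 0) (by decide)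
  have e3 := T (0, 1) (by decide); have e4 := T (0, -1) (by decide)
  rw [nnList_eq_map]
  unfold lineCE
  rw [peval_pscale, peval_psum]
  simp only [E4, List.map, List.sum_cons, List.sum_nil, add_zero, cst, RExpr.eval]
  push_cast
  linear_combination (1 / 2 : ℂ) * (e1 + e2 + e3 + e4)

/-- ★ line `C′`. -/
theorem lineCE'_eval (hL : 5 ≤ L) (hΔ0 : 0 ≤ Δ) (hΔ1 : Δ < 1) (hf : IsGroundTwoMagnon L Δ lam2 f) (hlam : 0 < lam2)
    (kp : Bool) (x y : Bool) {q : ℤ × ℤ} (hq : okB q = true) :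
    (L : ℂ) ^ 2 * peval (2 * Real.pi / L) (xTrueD L Δ lam2 f) (lineCE' (pvE kp) x y q)
      = (1 / 2) * ((nnList L).map (fun e =>
          ((pvR L Δ lam2 f kp : ℝ) : ℂ) * (closed2U L lam2 (psiU L Δ lam2 f x 1 0 e) (psiU L Δ lam2 f y 1 (-1) e) (B1.toTor L q)
          + closed2U L lam2 (psiU L Δ lam2 f y 1 0 (-e)) (psiU L Δ lam2 f x 1 (-1) (-e)) (B1.toTor L q)))).sum := by
  obtain ⟨hq0, hm⟩ := okB_imp hq
  have hp := eval_pvE L Δ lam2 f kp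
  have T : ∀ e ∈ E4, (L : ℂ) ^ 2 * peval (2 * Real.pi / L) (xTrueD L Δ lam2 f) (pscale (pvE kp) (padd (zPG x y q e) (zPG y x q (-e))))
      = ((pvR L Δ lam2 f kp : ℝ) : ℂ) * (closed2U L lam2 (psiU L Δ lam2 f x 1 0 (B1.toTor L e)) (psiU L Δ lam2 f y 1 (-1) (B1.toTor L e)) (B1.toTor L q)
        + closed2U L lam2 (psiU L Δ lam2 f y 1 0 (-(B1.toTor L e))) (psiU L Δ lam2 f x 1 (-1) (-(B1.toTor L e))) (B1.toTor L q)) := by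
    intro e he
    have A := zPG_eval L Δ lam2 f hL hΔ0 hΔ1 hf hlam x y (B1.toTor L e) hq0 e (hm e he)
    have B := zPG_eval L Δ lam2 f hL hΔ0 hΔ1 hf hlam y x (-(B1.toTor L e)) hq0 (-e) (by rw [natAbs_qdot_neg]; exact hm e he)
    rw [B1.toTor_neg] at B
    rw [peval_pscale, peval_padd, hp, ← A, ← B]; ring
  have e1 := T (1, 0) (by decide); have e2 := T (-1, 0) (by decide)
  have e3 := T (0, 1) (by decide); have e4 := T (0, -1) (by decide)
  rw [nnList_eq_map]
  unfold lineCE'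
  rw [peval_pscale, peval_psum]
  simp only [E4, List.map, List.sum_cons, List.sum_nil, add_zero, cst, RExpr.eval]
  push_cast
  linear_combination (1 / 2 : ℂ) * (e1 + e2 + e3 + e4)

/-- ★ line `C″`. -/
theorem lineCE''_eval (hL : 5 ≤ L) (hΔ0 : 0 ≤ Δ) (hΔ1 : Δ < 1) (hf : IsGroundTwoMagnon L Δ lam2 f) (hlam : 0 < lam2)
    (kp : Bool) (x y : Bool) {q : ℤ × ℤ} (hq : okB q = true) :
    (L : ℂ) ^ 2 * peval (2 * Real.pi / L) (xTrueD L Δ lam2 f) (lineCE'' (pvE kp) x y q)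
      = (1 / 2) * ((nnList L).map (fun e =>
          ((pvR L Δ lam2 f kp : ℝ) : ℂ) * (closed2U L lam2 (psiU L Δ lam2 f y 1 0 (-e)) (psiU L Δ lam2 f x 1 (-1) (-e)) (B1.toTor L q)
          + closed2U L lam2 (psiU L Δ lam2 f x 1 0 e) (psiU L Δ lam2 f y 1 (-1) e) (B1.toTor L q)))).sum := by
  obtain ⟨hq0, hm⟩ := okB_imp hq
  have hp := eval_pvE L Δ lam2 f kp
  have T : ∀ e ∈ E4, (L : ℂ) ^ 2 * peval (2 * Real.pi / L) (xTrueD L Δ lam2 f) (pscale (pvE kp) (padd (zPG y x q (-e)) (zPG x y q e)))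
      = ((pvR L Δ lam2 f kp : ℝ) : ℂ) * (closed2U L lam2 (psiU L Δ lam2 f y 1 0 (-(B1.toTor L e))) (psiU L Δ lam2 f x 1 (-1) (-(B1.toTor L e))) (B1.toTor L q)
        + closed2U L lam2 (psiU L Δ lam2 f x 1 0 (B1.toTor L e)) (psiU L Δ lam2 f y 1 (-1) (B1.toTor L e)) (B1.toTor L q)) := by
    intro e he
    have A := zPG_eval L Δ lam2 f hL hΔ0 hΔ1 hf hlam x y (B1.toTor L e) hq0 e (hm e he)
    have B := zPG_eval L Δ lam2 f hL hΔ0 hΔ1 hf hlam y x (-(B1.toTor L e)) hq0 (-e) (by rw [natAbs_qdot_neg]; exact hm e he)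
    rw [B1.toTor_neg] at B
    rw [peval_pscale, peval_padd, hp, ← A, ← B]; ring
  have e1 := T (1, 0) (by decide); have e2 := T (-1, 0) (by decide)
  have e3 := T (0, 1) (by decide); have e4 := T (0, -1) (by decide)
  rw [nnList_eq_map]
  unfold lineCE''
  rw [peval_pscale, peval_psum]
  simp only [E4, List.map, List.sum_cons, List.sum_nil, add_zero, cst, RExpr.eval]
  push_cast
  linear_combination (1 / 2 : ℂ) * (e1 + e2 + e3 + e4)

/-- ★ line `M` (`σ = false`: shifts by `e`; `σ = true`: shifts by `−e`). -/
theorem lineME_eval (hL : 7 ≤ L) (hΔ0 : 0 ≤ Δ) (hΔ1 : Δ < 1) (hf : IsGroundTwoMagnon L Δ lam2 f) (hlam : 0 < lam2)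
    (kp : Bool) (x y : Bool) (σ : Bool) {q : ℤ × ℤ} (hq : okB q = true) :
    (L : ℂ) ^ 2 * peval (2 * Real.pi / L) (xTrueD L Δ lam2 f) (lineME (pvE kp) x y σ q)
      = -(1 / 2) * (([ex L, -(ex L)] : List (Tor L)).map (fun e => (phase L (K1 L) e - 1) *
          (((pvR L Δ lam2 f kp : ℝ) : ℂ) * closed2U L lam2 (psiU L Δ lam2 f x 0 1 (if σ then -e else e)) (psiU L Δ lam2 f y 1 0 e) (B1.toTor L q)
          + ((pvR L Δ lam2 f kp : ℝ) : ℂ) * closed2U L lam2 (psiU L Δ lam2 f x 1 0 e) (psiU L Δ lam2 f y 0 1 (if σ then -e else e)) (B1.toTor L q)))).sum := by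
  obtain ⟨hq0, hm⟩ := okB_imp hq
  have hp := eval_pvE L Δ lam2 f kp
  have h0 := xTrueD_zero L Δ lam2 f
  obtain ⟨hex, hnex, -⟩ := toTor_named L
  have T : ∀ e : ℤ × ℤ, e ∈ E4 → (e = (1, 0) ∨ e = (-1, 0)) →
      (L : ℂ) ^ 2 * peval (2 * Real.pi / L) (xTrueD L Δ lam2 f)
        (ofS (pmulS (padd (pscale (pvE kp) (zSP x y q (if σ then -e else e))) (pscale (pvE kp) (zPS x y q (if σ then -e else e))))
          (sph (-(qdot exI e)))))
      = (phase L (K1 L) (B1.toTor L e) - 1) *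
          (((pvR L Δ lam2 f kp : ℝ) : ℂ) * closed2U L lam2 (psiU L Δ lam2 f x 0 1 (if σ then -(B1.toTor L e) else B1.toTor L e)) (psiU L Δ lam2 f y 1 0 (B1.toTor L e)) (B1.toTor L q)
          + ((pvR L Δ lam2 f kp : ℝ) : ℂ) * closed2U L lam2 (psiU L Δ lam2 f x 1 0 (B1.toTor L e)) (psiU L Δ lam2 f y 0 1 (if σ then -(B1.toTor L e) else B1.toTor L e)) (B1.toTor L q)) := by
    intro e he hx
    have hne := neg_mem_E4 e he
    have hz : (qdot (((0 : ℤ), (0 : ℤ)) + ((0 : ℤ), (0 : ℤ))) e).natAbs ≤ 3 := by simp [qdot]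
    have hz' : (qdot (exI - exI) e).natAbs ≤ 3 := by simp [qdot]
    have hpre := (prefactors L Δ lam2 f (by omega) e exI (0, 0) (0, 0) (by rcases hx with rfl | rfl <;> decide) hz hz').1
    have hσ : (if σ then -(B1.toTor L e) else B1.toTor L e) = B1.toTor L (if σ then -e else e) := by
      cases σ <;> simp [B1.toTor_neg]
    have hmσ : (qdot q (if σ then -e else e)).natAbs ≤ 3 := by
      cases σ
      · exact hm e he
      · simp only [if_true]; rw [natAbs_qdot_neg]; exact hm e he
    have A := zSP_eval L Δ lam2 f hL hΔ0 hΔ1 hf hlam x y hq0 (if σ then -e else e) hmσ (B1.toTor L e)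
    have B := zPS_eval L Δ lam2 f hL hΔ0 hΔ1 hf hlam x y hq0 (if σ then -e else e) hmσ (B1.toTor L e)
    rw [hσ, ← A, ← B, hpre, peval_ofS, seval_pmulS _ _ h0, peval_padd, peval_pscale, peval_pscale, hp]
    ring
  have e1 := T (1, 0) (by decide) (Or.inl rfl)
  have e2 := T (-1, 0) (by decide) (Or.inr rfl)
  rw [← hnex, ← hex]
  unfold lineME
  rw [peval_pscale, peval_psum]
  simp only [E2, List.map, List.sum_cons, List.sum_nil, add_zero, cst, RExpr.eval]
  push_cast
  linear_combination (-1 / 2 : ℂ) * (e1 + e2)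

/-- ★ `V·peval(bLinesE) = bClosedU(k̄₂,k̄₃)` (ground profile, `L ≥ 7`, `bOk k₂ k₃`). -/
theorem bLinesE_eval (hL : 7 ≤ L) (hΔ0 : 0 ≤ Δ) (hΔ1 : Δ < 1) (hf : IsGroundTwoMagnon L Δ lam2 f) (hlam : 0 < lam2)
    (k3 k1 k2 : Bool) {k₂ k₃ : ℤ × ℤ} (hok : bOk k₂ k₃ = true) :
    (L : ℂ) ^ 2 * peval (2 * Real.pi / L) (xTrueD L Δ lam2 f) (bLinesE k3 k1 k2 k₂ k₃)
      = bClosedU L Δ lam2 f k3 k1 k2 (B1.toTor L k₂) (B1.toTor L k₃) := by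
  have hL5 : 5 ≤ L := by omega
  simp only [bOk, Bool.and_eq_true] at hok
  obtain ⟨⟨⟨⟨⟨o3, o3'⟩, o2⟩, o2'⟩, o23⟩, o23'⟩ := hok
  have ht2 : B1.toTor L k₂ - K1 L = B1.toTor L (k₂ - exI) := by rw [K1_eq_toTor, ← RowC.toTor_sub]; rfl
  have ht3 : B1.toTor L k₃ - K1 L = B1.toTor L (k₃ - exI) := by rw [K1_eq_toTor, ← RowC.toTor_sub]; rfl
  have ht23 : B1.toTor L k₂ + B1.toTor L k₃ = B1.toTor L (k₂ + k₃) := by rw [B1.toTor_add]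
  have ht23' : B1.toTor L k₂ + B1.toTor L k₃ - K1 L = B1.toTor L (k₂ + k₃ - exI) := by
    rw [ht23, K1_eq_toTor, ← RowC.toTor_sub]; rfl
  -- the nine pieces
  have A1 := lineCE_eval L Δ lam2 f hL5 hΔ0 hΔ1 hf hlam k1 k3 k2 o3
  have A2 := lineCE_eval L Δ lam2 f hL5 hΔ0 hΔ1 hf hlam k1 k3 k2 o3'
  have A3 := lineME_eval L Δ lam2 f hL hΔ0 hΔ1 hf hlam k1 k2 k3 false o3
  have B1' := lineCE'_eval L Δ lam2 f hL5 hΔ0 hΔ1 hf hlam k2 k3 k1 o2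
  have B2 := lineCE'_eval L Δ lam2 f hL5 hΔ0 hΔ1 hf hlam k2 k3 k1 o2'
  have B3 := lineME_eval L Δ lam2 f hL hΔ0 hΔ1 hf hlam k2 k1 k3 false o2
  have D1 := lineCE''_eval L Δ lam2 f hL5 hΔ0 hΔ1 hf hlam k3 k1 k2 o23
  have D2 := lineCE''_eval L Δ lam2 f hL5 hΔ0 hΔ1 hf hlam k3 k1 k2 o23'
  have D3 := lineME_eval L Δ lam2 f hL hΔ0 hΔ1 hf hlam k3 k1 k2 true o23'
  simp only [Bool.false_eq_true, if_false, if_true] at A3 B3 D3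
  unfold bClosedU bLinesG
  simp only []
  rw [ht3, ht2, ht23', ht23, ← A1, ← A2, ← A3, ← B1', ← B2, ← B3, ← D1, ← D2, ← D3]
  unfold bLinesE
  simp only [peval_padd, peval_pscale, cst, RExpr.eval]
  push_cast
  ring

/-- ★ `V²·t·peval(bTermE) = bClosedU(k̄₂,k̄₃)` (ground profile, `L ≥ 7`, `bOk k₂ k₃`). -/
theorem bTermE_eval (hL : 7 ≤ L) (hΔ0 : 0 ≤ Δ) (hΔ1 : Δ < 1) (hf : IsGroundTwoMagnon L Δ lam2 f) (hlam : 0 < lam2)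
    (k3 k1 k2 : Bool) {k₂ k₃ : ℤ × ℤ} (hok : bOk k₂ k₃ = true) :
    ((L : ℂ) ^ 2) ^ 2 * ((((2 * Real.pi / L) ^ 2 : ℝ) : ℂ)
        * peval (2 * Real.pi / L) (xTrueD L Δ lam2 f) (bTermE k3 k1 k2 k₂ k₃))
      = bClosedU L Δ lam2 f k3 k1 k2 (B1.toTor L k₂) (B1.toTor L k₃) := by
  rw [← bLinesE_eval L Δ lam2 f hL hΔ0 hΔ1 hf hlam k3 k1 k2 hok]
  unfold bTermE
  rw [peval_pscale]
  simp only [cst, vPi2, RExpr.eval, xTrueD_one]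
  have hL0 : (L : ℂ) ≠ 0 := by exact_mod_cast NeZero.ne L
  have hπ : (Real.pi : ℂ) ≠ 0 := by exact_mod_cast Real.pi_ne_zero
  push_cast
  field_simp
  ring

end assembly

end RowD

end Summit.HubbardSuperconductivity.HubbardSuperconductivity.Theorems.AnisotropyChord.Transfer.Fibre3
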